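import Summits.ResolutionOfSingularities.ResolutionOfSingularities.Theorems.EquisingularLiftEquisingularLiftNatResidueHypDefsND
import Mathlib.LinearAlgebra.Matrix.Determinant.Basic
import Mathlib.LinearAlgebra.Matrix.NonsingularInverse
import HarnessLib

/-!
# [OURS · L1 W4.5(b) · EL♮(3)] ND CHART DICTIONARY (1/3) — `…NatNDChartPullback`: monomial charts of a smooth cone, pull-back `chartPull` and STRICT TRANSFORM
# `toricStrict` of a polynomial, and the E1 dictionary `Bad V τ_I ⟺ V(y_i : i ∈ I) ⊆ {strict transform = 0}` (`bad_iff_toricStrict_vanishes`)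

OURS · L1 W4.5(b) · EL♮(3) stmt-ResolutionOfSingularities-20148 · counted 0 · AI-written (res-L1-w45b-idea-1 g22; landed in the text owner's lane by res-L1-w45b-lead-2 g6 on
idea-1's OFFER R8-4), weaker than expert review; nothing of [Hironaka2017] asserted; no statement of the manuscript. Sorry-free, axioms standard, no instance, no
notation. `--supports stmt-ResolutionOfSingularities-20148 --as helper`: support module toward the registered 4th CHILD stub
`stub_elnat_three_isolated_newtonNondegenerate` (`IsoHypNDWon → ELNatConclusionO`, first unproved lemma `nd_rung_local`): this is the PROVED `k`-SIDE of that
rung's toric dictionary; the `O`-side plumbing (O1)–(O5) of `Cruxes/EquisingularLiftNatThree/NewtonNondegenerateRung.lean` §10.3 is untouched.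
SOURCE = idea-1's companion `Cruxes/EquisingularLiftNatThree/NewtonNondegenerateRungCharts.lean` sha16 54ad50e211ef87b7 (658 l., farm rc 0 · 0 sorries), bodies
VERBATIM; tree home = namespace `…Cruxes.EquisingularLiftNat.Sections.ND` (text owner's ruling on R8-4), imports route-independent, prelude lemmas public, split by
the 400-line rule into `…NatNDChartPullback` (§12.1–§12.2) → `…NatNDChartEnd` (§12.3) → `…NatNDChartPlays` (§12.4–§12.6).
-/

noncomputable section

set_option linter.dupNamespace false

open MvPolynomial

namespace Summit.ResolutionOfSingularities.ResolutionOfSingularities.Cruxes.EquisingularLiftNat.Sections.ND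

open Summit.ResolutionOfSingularities.ResolutionOfSingularities.Cruxes.EquisingularLiftNat.Sections

variable {k : Type} [Field k] {N : ℕ} {n : ℕ}

/-- A locally Newton-nondegenerate polynomial is non-zero (the zero polynomial has a singular torus zero of its initial form). [OURS · ND chart dictionary, res-L1-w45b-idea-1 g22] -/
theorem ne_zero_of_isLocallyND {g : MvPolynomial (Fin N) k} (h : IsLocallyNewtonNondegenerate g) : g ≠ 0 := by
  rintro rfl
  refine h (fun _ => 1) (fun _ => one_pos) (fun _ => 1) (fun _ => one_ne_zero) ?_ ?_
  · unfold initialForm; simp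
  · intro i; unfold initialForm; simp

/-- A non-zero polynomial has a non-empty exponent table. [OURS · ND chart dictionary, res-L1-w45b-idea-1 g22] -/
theorem table_nonempty {g : MvPolynomial (Fin N) k} (hg : g ≠ 0) : (table g).Nonempty := by
  unfold table
  rw [Finset.image_nonempty, support_nonempty]
  exact hg

/-- `Bad` is monotone in the face: a face containing a `Bad` face is `Bad`. [OURS · ND chart dictionary, res-L1-w45b-idea-1 g22] -/
theorem bad_mono (V : Finset (Fin n → ℕ)) {τ σ : Finset (Ray n)} (h : τ ⊆ σ) (hτ : Bad V τ) : Bad V σ := by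
  rintro ⟨m, hm, hmin⟩
  exact hτ ⟨m, hm, fun ρ hρ m' hm' => hmin ρ (h hρ) m' hm'⟩

/-! ### 12.1 Monomial charts: pull-back and strict transform of a polynomial in the chart `U_B` of a smooth cone -/

/-- The `ℕ`-pairing of a chart ray (natural coordinates) with an exponent vector. -/
def pairN (b m : Fin n → ℕ) : ℕ := ∑ l, b l * m l

/-- A natural-coordinate ray as a `Ray n`. -/
def rayOf (b : Fin n → ℕ) : Ray n := fun l => (b l : ℤ)

/-- The `ℤ`-pairing of a natural ray is the cast of the `ℕ`-pairing. [OURS · ND chart dictionary, res-L1-w45b-idea-1 g22] -/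
theorem pair_rayOf (b m : Fin n → ℕ) : pair (rayOf b) m = (pairN b m : ℤ) := by
  simp only [pair, rayOf, pairN, Nat.cast_sum, Nat.cast_mul]

/-- `h_V(b) = min_{m ∈ V} ⟨b, m⟩` — the order of vanishing of the pulled-back equation along the divisor of the ray `b` (`0` on the empty table). -/
def hminN (V : Finset (Fin n → ℕ)) (b : Fin n → ℕ) : ℕ :=
  if hV : V.Nonempty then V.inf' hV (pairN b) else 0

/-- `hminN V b` is a lower bound of the pairings `⟨b, m⟩`, `m ∈ V`. [OURS · ND chart dictionary, res-L1-w45b-idea-1 g22] -/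
theorem hminN_le {V : Finset (Fin n → ℕ)} (b : Fin n → ℕ) {m : Fin n → ℕ} (hm : m ∈ V) : hminN V b ≤ pairN b m := by
  unfold hminN; rw [dif_pos ⟨m, hm⟩]; exact Finset.inf'_le _ hm

/-- The minimum `hminN V b` is attained on a non-empty table. [OURS · ND chart dictionary, res-L1-w45b-idea-1 g22] -/
theorem exists_pairN_eq_hminN {V : Finset (Fin n → ℕ)} (hV : V.Nonempty) (b : Fin n → ℕ) :
    ∃ m ∈ V, pairN b m = hminN V b := by
  unfold hminN; rw [dif_pos hV]
  obtain ⟨m, hm, h⟩ := Finset.exists_mem_eq_inf' hV (pairN b)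
  exact ⟨m, hm, h.symm⟩

/-- The exponent of `t^m` pulled back to the chart `U_B` (`t_l = ∏_i y_i^{B i l}`): `(⟨B i, m⟩)_i`. -/
def chartExp (B : Fin n → Fin n → ℕ) (m : Fin n → ℕ) : Fin n → ℕ := fun i => pairN (B i) m

/-- The exponent of `t^m` in the STRICT transform: `(⟨B i, m⟩ − h_V(B i))_i`. -/
def strictExp (B : Fin n → Fin n → ℕ) (V : Finset (Fin n → ℕ)) (m : Fin n → ℕ) : Fin n → ℕ :=
  fun i => pairN (B i) m - hminN V (B i)

/-- Strict-transform exponent + the minimum = the chart exponent (componentwise). [OURS · ND chart dictionary, res-L1-w45b-idea-1 g22] -/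
theorem strictExp_add_hminN (B : Fin n → Fin n → ℕ) {V : Finset (Fin n → ℕ)} {m : Fin n → ℕ} (hm : m ∈ V) (i : Fin n) :
    strictExp B V m i + hminN V (B i) = chartExp B m i :=
  Nat.sub_add_cancel (hminN_le (B i) hm)

/-- Plain exponent vector ↦ finsupp. -/
def toFs (v : Fin n → ℕ) : Fin n →₀ ℕ := Finsupp.equivFunOnFinite.symm v

/-- `toFs v` evaluates as `v`. [OURS · ND chart dictionary, res-L1-w45b-idea-1 g22] -/
@[simp] theorem toFs_apply (v : Fin n → ℕ) (i : Fin n) : toFs v i = v i := by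
  simp [toFs]

/-- Coercion of `toFs v` back to a function is `v`. [OURS · ND chart dictionary, res-L1-w45b-idea-1 g22] -/
theorem coe_toFs (v : Fin n → ℕ) : (⇑(toFs v) : Fin n → ℕ) = v := by
  funext i; exact toFs_apply v i

/-- `toFs` is injective. [OURS · ND chart dictionary, res-L1-w45b-idea-1 g22] -/
theorem toFs_injective : Function.Injective (toFs (n := n)) := Finsupp.equivFunOnFinite.symm.injective

/-- `toFs` of the coercion of a finitely supported function is that function. [OURS · ND chart dictionary, res-L1-w45b-idea-1 g22] -/
theorem toFs_coe (d : Fin n →₀ ℕ) : toFs (⇑d) = d := by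
  ext i; exact toFs_apply _ i

/-- THE CHART PULL-BACK `g(y^B) = Σ_m c_m · y^{chartExp B m}` of `g = Σ_m c_m t^m`. -/
def chartPull (B : Fin n → Fin n → ℕ) (g : MvPolynomial (Fin n) k) : MvPolynomial (Fin n) k :=
  ∑ d ∈ g.support, monomial (toFs (chartExp B ⇑d)) (coeff d g)

/-- THE STRICT TRANSFORM of `{g = 0}` in the chart `U_B`: `y^{-h} · g(y^B) = Σ_m c_m · y^{strictExp B V m}`, `V = table g`. -/
def toricStrict (B : Fin n → Fin n → ℕ) (g : MvPolynomial (Fin n) k) : MvPolynomial (Fin n) k :=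
  ∑ d ∈ g.support, monomial (toFs (strictExp B (table g) ⇑d)) (coeff d g)

/-- The exceptional exponent `h = (h_V(B i))_i`. -/
def hVec (B : Fin n → Fin n → ℕ) (V : Finset (Fin n → ℕ)) : Fin n → ℕ := fun i => hminN V (B i)

/-- The coercion of a support exponent lies in the table. [OURS · ND chart dictionary, res-L1-w45b-idea-1 g22] -/
theorem coe_mem_table {g : MvPolynomial (Fin n) k} {d : Fin n →₀ ℕ} (hd : d ∈ g.support) : (⇑d : Fin n → ℕ) ∈ table g :=
  Finset.mem_image_of_mem _ hd

/-- Membership in the table ⟺ membership of `toFs` in the support. [OURS · ND chart dictionary, res-L1-w45b-idea-1 g22] -/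
theorem mem_table_iff {g : MvPolynomial (Fin n) k} {m : Fin n → ℕ} : m ∈ table g ↔ toFs m ∈ g.support := by
  unfold table; rw [Finset.mem_image]
  constructor
  · rintro ⟨d, hd, rfl⟩; rwa [toFs_coe]
  · intro h; exact ⟨toFs m, h, coe_toFs m⟩

/-- `g(y^B) = y^h · (strict transform)`: the exceptional monomial factors out EXACTLY. -/
theorem chartPull_eq (B : Fin n → Fin n → ℕ) (g : MvPolynomial (Fin n) k) :
    chartPull B g = monomial (toFs (hVec B (table g))) 1 * toricStrict B g := by
  unfold chartPull toricStrict
  rw [Finset.mul_sum]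
  refine Finset.sum_congr rfl fun d hd => ?_
  rw [monomial_mul, one_mul]
  have hexp : toFs (hVec B (table g)) + toFs (strictExp B (table g) ⇑d) = toFs (chartExp B ⇑d) := by
    ext i
    rw [Finsupp.add_apply, toFs_apply, toFs_apply, toFs_apply, hVec, add_comm]
    exact strictExp_add_hminN B (coe_mem_table hd) i
  rw [hexp]

/-- `chartPull` IS the monomial substitution `t_l ↦ ∏_i y_i^{B i l}` (the toric chart map `U_B → 𝔸ⁿ`). -/
theorem chartPull_eq_aeval (B : Fin n → Fin n → ℕ) (g : MvPolynomial (Fin n) k) :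
    chartPull B g = aeval (fun l => ∏ i, (X i : MvPolynomial (Fin n) k) ^ B i l) g := by
  conv_rhs => rw [g.as_sum]
  rw [map_sum]
  unfold chartPull
  refine Finset.sum_congr rfl fun d hd => ?_
  rw [aeval_monomial, algebraMap_eq, Finsupp.prod_fintype _ _ (fun _ => pow_zero _), monomial_eq,
    Finsupp.prod_fintype _ _ (fun _ => pow_zero _)]
  congr 1
  have h1 : ∀ l, (∏ i, (X i : MvPolynomial (Fin n) k) ^ B i l) ^ (d l) = ∏ i, (X i : MvPolynomial (Fin n) k) ^ (B i l * d l) :=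
    fun l => by rw [← Finset.prod_pow]; exact Finset.prod_congr rfl fun i _ => (pow_mul _ _ _).symm
  simp only [h1, toFs_apply, chartExp, pairN]
  rw [Finset.prod_comm]
  exact Finset.prod_congr rfl fun i _ => (Finset.prod_pow_eq_pow_sum _ _ _).symm

/-- The support of the strict transform consists of strict-transform exponents of table members. [OURS · ND chart dictionary, res-L1-w45b-idea-1 g22] -/
theorem support_toricStrict_subset (B : Fin n → Fin n → ℕ) (g : MvPolynomial (Fin n) k) :
    (toricStrict B g).support ⊆ g.support.image (fun d : Fin n →₀ ℕ => toFs (strictExp B (table g) ⇑d)) := by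
  classical
  intro e he
  unfold toricStrict at he
  obtain ⟨d, hd, he'⟩ := Finset.mem_biUnion.1 (support_sum he)
  rw [Finset.mem_image]
  exact ⟨d, hd, (Finset.mem_singleton.1 (support_monomial_subset he')).symm⟩

/-! ### 12.2 THE E1 DICTIONARY: `Bad V τ_I` ⟺ `V(y_i : i ∈ I) ⊆ {strict transform = 0}` in the chart -/

/-- **E1 ⟸ `Bad` (PROVED, no hypothesis on the chart).**  If the face `τ_I = {B i : i ∈ I}` is `Bad` for the table of `g`, EVERY monomial of the strict
transform involves a variable `y_i`, `i ∈ I`: the orbit closure `V(τ_I) = {y_i = 0, i ∈ I}` lies inside the strict transform of `{g = 0}`. -/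
theorem toricStrict_vanishes_of_bad (B : Fin n → Fin n → ℕ) (g : MvPolynomial (Fin n) k) (I : Finset (Fin n))
    (hBad : Bad (table g) (I.image fun i => rayOf (B i))) :
    ∀ e ∈ (toricStrict B g).support, ∃ i ∈ I, e i ≠ 0 := by
  classical
  intro e he
  obtain ⟨d, hd, rfl⟩ := Finset.mem_image.1 (support_toricStrict_subset B g he)
  by_contra hcon
  simp only [not_exists, not_and, not_not, toFs_apply] at hcon
  apply hBad
  refine ⟨⇑d, coe_mem_table hd, ?_⟩
  intro ρ hρ m' hm'
  obtain ⟨i, hi, rfl⟩ := Finset.mem_image.1 hρ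
  rw [pair_rayOf, pair_rayOf]
  exact_mod_cast (Nat.sub_eq_zero_iff_le.1 (hcon i hi)).trans (hminN_le (B i) hm')

/-- **E1 ⟹ `Bad` (PROVED, for a chart whose exponent map is injective on the table — e.g. any smooth cone, `chartExp_injective_of_det_ne_zero`).** -/
theorem bad_of_toricStrict_vanishes (B : Fin n → Fin n → ℕ) (g : MvPolynomial (Fin n) k) (hinj : Set.InjOn (chartExp B) (table g))
    (I : Finset (Fin n)) (h : ∀ e ∈ (toricStrict B g).support, ∃ i ∈ I, e i ≠ 0) :
    Bad (table g) (I.image fun i => rayOf (B i)) := by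
  classical
  rintro ⟨m, hm, hmin⟩
  have hmi : ∀ i ∈ I, strictExp B (table g) m i = 0 := by
    intro i hi
    apply Nat.sub_eq_zero_of_le
    obtain ⟨m', hm', hm'eq⟩ := exists_pairN_eq_hminN ⟨m, hm⟩ (B i)
    rw [← hm'eq]
    have := hmin (rayOf (B i)) (Finset.mem_image_of_mem _ hi) m' hm'
    rwa [pair_rayOf, pair_rayOf, Nat.cast_le] at this
  have hcoeff : coeff (toFs (strictExp B (table g) m)) (toricStrict B g) = coeff (toFs m) g := by
    unfold toricStrict
    rw [coeff_sum, Finset.sum_eq_single_of_mem (toFs m) (mem_table_iff.1 hm)]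
    · rw [coeff_monomial, if_pos]; rw [coe_toFs]
    · intro d hd hne
      rw [coeff_monomial, if_neg]
      intro heq
      apply hne
      have h1 : strictExp B (table g) ⇑d = strictExp B (table g) m := toFs_injective heq
      have h2 : chartExp B ⇑d = chartExp B m := by
        funext i
        rw [← strictExp_add_hminN B (coe_mem_table hd) i, ← strictExp_add_hminN B hm i, h1]
      rw [← toFs_coe d, hinj (coe_mem_table hd) hm h2]
  have he : toFs (strictExp B (table g) m) ∈ (toricStrict B g).support := by
    rw [mem_support_iff, hcoeff, ← mem_support_iff]; exact mem_table_iff.1 hm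
  obtain ⟨i, hi, hne⟩ := h _ he
  exact hne (by rw [toFs_apply, hmi i hi])

/-- Smooth charts are injective on exponents: if `det B ≠ 0` (in `ℤ`), `m ↦ chartExp B m` is injective. -/
theorem chartExp_injective_of_det_ne_zero (B : Fin n → Fin n → ℕ) (hB : (Matrix.of fun i l => (B i l : ℤ)).det ≠ 0) :
    Function.Injective (chartExp B) := by
  intro m m' h
  have hv : (Matrix.of fun i l => (B i l : ℤ)).mulVec (fun l => (m l : ℤ) - m' l) = 0 := by
    funext i
    have hi := congrFun h i
    simp only [chartExp, pairN] at hi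
    simp only [Matrix.mulVec, dotProduct, Matrix.of_apply, Pi.zero_apply, mul_sub, Finset.sum_sub_distrib]
    rw [sub_eq_zero]
    exact_mod_cast hi
  have := Matrix.eq_zero_of_mulVec_eq_zero hB hv
  funext l
  have hl := congrFun this l
  simp only [Pi.zero_apply, sub_eq_zero] at hl
  exact_mod_cast hl

/-- **E1 ⟺ `Bad`** for a chart with `det B ≠ 0`: the face `τ_I` is `Bad` iff every monomial of the strict transform involves a variable `y_i`, `i ∈ I`. [OURS · ND chart dictionary, res-L1-w45b-idea-1 g22] -/
theorem bad_iff_toricStrict_vanishes (B : Fin n → Fin n → ℕ) (hB : (Matrix.of fun i l => (B i l : ℤ)).det ≠ 0)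
    (g : MvPolynomial (Fin n) k) (I : Finset (Fin n)) :
    Bad (table g) (I.image fun i => rayOf (B i)) ↔ ∀ e ∈ (toricStrict B g).support, ∃ i ∈ I, e i ≠ 0 :=
  ⟨toricStrict_vanishes_of_bad B g I,
    bad_of_toricStrict_vanishes B g ((chartExp_injective_of_det_ne_zero B hB).injOn) I⟩

end Summit.ResolutionOfSingularities.ResolutionOfSingularities.Cruxes.EquisingularLiftNat.Sections.ND

end
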